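import Literature.Topology.FourManifolds.NormalFramingOfCircle
import Literature.Topology.FourManifolds.MilnorLambdaPath
import HarnessLib

/-!
# Normal framings of embedded circles in orientable manifolds of any dimension

Topic `Literature/Topology/FourManifolds`.  Generic-dimension form of the tree's
`exists_normalFraming_of_isOrientable_holds` (`NormalFramingOfCircle.lean`, stated there for
4-manifolds because the closing path was built in `GL⁺(3, ℝ)` only, `CircleFramingSplice.lean`):

*Let `X` be a `C^∞` manifold charted on `ℝᵐ⁺¹` carrying a smooth orientation and
`c : 𝕊¹ → X` a `C^∞` immersion of the circle. Then there is a family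
`N u : ℝᵐ →L[ℝ] ℝᵐ⁺¹ = T_{c u} X`, smooth along `c` (`IsSmoothAlong`), with
`(mfderiv c u).coprod (N u)` bijective for every `u`* — a framing of the normal bundle of `c`
(`exists_normalFraming_of_smoothOrientation`).

This is Hirsch, *Differential Topology* (1976), Ch. 4 §4, Exercise 2 (p. 108: an orientable
`n`-plane bundle over `S¹` is trivial) for the pull-back `c^*TX` with its tangent line split
off, in every dimension; it is needed in dimension `5` for Milnor's surgery killing the
fundamental group of a 5-dimensional cobordism (Milnor 1961, Thm. 3; Wall 1964, p. 142; Kirby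
1989, p. 55: the circles to be surgered are framed because the cobordism is orientable), where
it feeds the tree's tube `exists_framedSphereFamily_halfSpace_of_isSmoothAlong`
(`SphereTubeInInterior.lean`).  The walk of `CircleFramingWalk.lean` (`exists_walkInv_one`) and the
orientation character of `NormalFramingOfCircle.lean` (`posChar_iff_posChar`, `posChar_map_iff`)
are already generic in the fibre `F`; what is generalised here is

* `CircleFraming.exists_clmPath_of_det_pos` — **`GL⁺(F)` is smoothly path connected** for every
  finite-dimensional real normed space `F` (from the tree's matrix statement
  `exists_path_of_det_pos`, `MilnorLambdaPath.lean`: Gaussian elimination, Milnor 1965 p. 33);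
* `CircleFraming.exists_closingPath'` — the closing path of `CircleFramingSplice.lean` for a
  generic fibre `F` (`dim E = dim F + 1`);
* `CircleFraming.exists_loopFrame'` — the periodic frame field along a smooth `1`-periodic
  loop in an oriented manifold, generic fibre (proof verbatim from `exists_loopFrame`);
* `chartVec_loop_eq'`, `chartVec_loop_ne_zero'` and
  `exists_normalFraming_of_smoothOrientation` — the descent to `𝕊¹` (proof verbatim from
  `exists_normalFraming_of_isOrientable_holds`, with `ℝ⁴, ℝ³` replaced by `ℝᵐ⁺¹, ℝᵐ` and the
  embedding hypothesis weakened to an immersion, which is all the proof uses).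

Everything is proved; no definitions, no named facts.

## References

* M. W. Hirsch, *Differential Topology*, GTM 33 (1976), Ch. 4 §4, Exercise 2 (p. 108) and the
  paragraph preceding Lemma 4.1; Ch. 4 §6, proof of Thm. 6.6. [HirschDT1976]
* J. Milnor, *Lectures on the h-cobordism theorem* (1965), proof of Lemma 5.7, Assertion
  (PDF p. 33). [MilnorHCobordism1965]
* J. Milnor, *A procedure for killing homotopy groups of differentiable manifolds*, Proc.
  Sympos. Pure Math. III (1961), Thm. 3 (context of use). [MilnorKilling1961]
-/

open Set Function Filter
open scoped Manifold Topology ContDiff RealInnerProductSpace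

noncomputable section

namespace Literature.Topology.FourManifolds.CircleFraming

/-- Local notation: `𝔼 n` is the model Euclidean space `EuclideanSpace ℝ (Fin n)`. -/
local notation "𝔼 " n:arg => EuclideanSpace ℝ (Fin n)

/-! ### Smooth paths in `GL⁺(F)` -/

section PosDetPathGeneral

variable {F : Type*} [NormedAddCommGroup F] [NormedSpace ℝ F] [FiniteDimensional ℝ F]

/-- **`GL⁺(F)` is smoothly path connected** (any finite-dimensional real normed space `F`): an
automorphism `H` of `F` with `det H > 0` is joined to the identity by a smooth path of
automorphisms — read `H` as a matrix in a basis and use the matrix path of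
`exists_path_of_det_pos` (`MilnorLambdaPath.lean`), reparametrised by Mathlib's smooth
transition so as to be defined (and constant outside `[0, 1]`) on all of `ℝ`.
[cite: MilnorHCobordism1965, proof of Lemma 5.7, Assertion (PDF p. 33)] -/
theorem exists_clmPath_of_det_pos (H : F →L[ℝ] F) (hH : 0 < H.det) :
    ∃ Hp : ℝ → (F →L[ℝ] F), ContDiff ℝ ∞ Hp ∧ Hp 0 = 1 ∧ Hp 1 = H ∧ ∀ s, Bijective (Hp s) := by
  classical
  let b := Module.finBasis ℝ F
  let e : F ≃L[ℝ] (Fin (Module.finrank ℝ F) → ℝ) := b.equivFun.toContinuousLinearEquiv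
  let H' : (Fin (Module.finrank ℝ F) → ℝ) →L[ℝ] (Fin (Module.finrank ℝ F) → ℝ) :=
    (e : F →L[ℝ] (Fin (Module.finrank ℝ F) → ℝ)).comp
      (H.comp (e.symm : (Fin (Module.finrank ℝ F) → ℝ) →L[ℝ] F))
  let A : Matrix (Fin (Module.finrank ℝ F)) (Fin (Module.finrank ℝ F)) ℝ :=
    LinearMap.toMatrix' (H' : (Fin (Module.finrank ℝ F) → ℝ) →ₗ[ℝ] (Fin (Module.finrank ℝ F) → ℝ))
  have hdetA : A.det = H.det := by
    rw [LinearMap.det_toMatrix']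
    exact LinearMap.det_conj (H : F →ₗ[ℝ] F) e.toLinearEquiv
  have hd : 0 < A.det := by rw [hdetA]; exact hH
  obtain ⟨γ, hγ, hγ0, hγ1, hγdet⟩ :=
    Literature.Topology.FourManifolds.exists_path_of_det_pos A hd
  -- matrices acting as continuous linear maps
  let matL : Matrix (Fin (Module.finrank ℝ F)) (Fin (Module.finrank ℝ F)) ℝ →
      ((Fin (Module.finrank ℝ F) → ℝ) →L[ℝ] (Fin (Module.finrank ℝ F) → ℝ)) :=
    fun P => LinearMap.toContinuousLinearMap (Matrix.toLin' P)
  have hmatL : ∀ P x, matL P x = P.mulVec x := fun P x => by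
    simp [matL, Matrix.toLin'_apply]
  -- the reparametrisation `ρ s = 1 - smoothTransition s ∈ [0, 1]`
  let ρ : ℝ → ℝ := fun s => 1 - Real.smoothTransition s
  have hρ : ContDiff ℝ ∞ ρ := contDiff_const.sub Real.smoothTransition.contDiff
  have hρI : ∀ s, ρ s ∈ Icc (0 : ℝ) 1 := fun s =>
    ⟨sub_nonneg.2 (Real.smoothTransition.le_one s),
      sub_le_self _ (Real.smoothTransition.nonneg s)⟩
  refine ⟨fun s => (e.symm : (Fin (Module.finrank ℝ F) → ℝ) →L[ℝ] F).comp
      ((matL (γ (ρ s))).comp (e : F →L[ℝ] (Fin (Module.finrank ℝ F) → ℝ))), ?_, ?_, ?_,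
    fun s => ?_⟩
  · -- smoothness
    have hm : ContDiff ℝ ∞ fun s => matL (γ (ρ s)) := by
      rw [contDiff_clm_apply_iff]
      intro x
      simp only [hmatL]
      rw [contDiff_pi]
      intro i
      simp only [Matrix.mulVec, dotProduct]
      exact ContDiff.sum fun j _ => ((hγ i j).comp hρ).mul contDiff_const
    exact contDiff_const.clm_comp (hm.clm_comp contDiff_const)
  · -- value at `0`
    have hρ0 : ρ 0 = 1 := by
      simp only [ρ, Real.smoothTransition.zero_of_nonpos le_rfl, sub_zero]
    beta_reduce
    rw [hρ0, hγ1]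
    ext1 v
    simp [hmatL]
  · -- value at `1`
    have hρ1 : ρ 1 = 0 := by
      simp only [ρ, Real.smoothTransition.one_of_one_le le_rfl, sub_self]
    beta_reduce
    rw [hρ1, hγ0]
    have hA : matL A = H' := by
      ext1 x
      simp only [matL, LinearMap.coe_toContinuousLinearMap', A, Matrix.toLin'_toMatrix']
      rfl
    rw [hA]
    ext1 v
    simp [H']
  · -- bijectivity
    have hdet : 0 < (γ (ρ s)).det := hγdet _ (hρI s)
    have hunit : IsUnit (Matrix.toLin' (γ (ρ s))) := by
      rw [LinearMap.isUnit_iff_isUnit_det, LinearMap.det_toLin']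
      exact isUnit_iff_ne_zero.2 hdet.ne'
    have hbij : Bijective (matL (γ (ρ s))) := by
      simp only [matL]
      exact (Module.End.isUnit_iff _).1 hunit
    rw [ContinuousLinearMap.coe_comp, ContinuousLinearMap.coe_comp]
    exact e.symm.bijective.comp (hbij.comp e.bijective)

end PosDetPathGeneral

/-! ### The closing path, generic fibre -/

section ClosingGeneral

variable {E : Type*} [NormedAddCommGroup E] [NormedSpace ℝ E] [FiniteDimensional ℝ E]
  {F : Type*} [NormedAddCommGroup F] [NormedSpace ℝ F] [FiniteDimensional ℝ F]
  (R : E ≃L[ℝ] ℝ × F)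

/-- **The closing path, generic fibre.** If `M` and `G` both complete `T ∈ E`
(`dim E = dim F + 1`) with frame determinants of the same sign, there is a smooth path of frames
of `T` from `G` to `M`: decompose `G = b ⊗ T + M ∘ H` with `det H > 0`
(`IsFrame.exists_decomp`) and contract `b` linearly while running `H` to `1` in `GL⁺(F)`
(`exists_clmPath_of_det_pos`). [cite: HirschDT1976, Ch. 4 §6, proof of Thm. 6.6] -/
theorem exists_closingPath' {T : E} {M G : F →L[ℝ] E} (hM : IsFrame T M) (hG : IsFrame T G)
    (hsign : 0 < frameDet R T M * frameDet R T G) :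
    ∃ π : ℝ → (F →L[ℝ] E), ContDiff ℝ ∞ π ∧ π 0 = G ∧ π 1 = M ∧ ∀ s, IsFrame T (π s) := by
  obtain ⟨b, H, hGeq, -, hiff⟩ := hM.exists_decomp R hG
  obtain ⟨Hp, hHp, hHp0, hHp1, hHpbij⟩ := exists_clmPath_of_det_pos H (hiff.1 hsign)
  refine ⟨fun s => (1 - s) • b.smulRight T + M.comp (Hp (1 - s)), ?_, ?_, ?_, fun s => ?_⟩
  · exact ((contDiff_const.sub contDiff_id).smul contDiff_const).add
      (contDiff_const.clm_comp (hHp.comp (contDiff_const.sub contDiff_id)))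
  · simp only [sub_zero, one_smul, hHp1]
    exact hGeq.symm
  · simp only [sub_self, zero_smul, zero_add, hHp0]
    ext1 w
    rfl
  · have : (1 - s) • b.smulRight T = ((1 - s) • b).smulRight T := by
      ext1 w
      simp [smul_smul]
    simp only [this]
    exact hM.smulRight_add_comp _ (hHpbij _)

end ClosingGeneral

/-! ### Closing the loop, generic fibre -/

section LoopGeneral

variable {E : Type*} [NormedAddCommGroup E] [InnerProductSpace ℝ E] [FiniteDimensional ℝ E]
  {F : Type*} [NormedAddCommGroup F] [NormedSpace ℝ F] [FiniteDimensional ℝ F]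
  {X : Type*} [TopologicalSpace X] [ChartedSpace E X] [IsManifold 𝓘(ℝ, E) ∞ X] {γ : ℝ → X}

/-- Local notation: the derivative cocycle of the chart changes of `X`. -/
local notation "τ" => tangentCoordChange 𝓘(ℝ, E)

/-- **A frame field along a smooth loop in an oriented manifold, generic fibre.** Let `γ : ℝ → X`
be a smooth `1`-periodic curve with nonvanishing chart velocities in a manifold `X` charted on
`E` (`dim E = dim F + 1`) carrying a smooth orientation, and let `M₀ : F → E` complete the
velocity at `0` (read in the chart at `γ 0`). Then there is a frame field `Nf` along `γ`,
chartwise smooth on a neighbourhood of `[0, 1]`, consisting of frames on `[0, 1]`, and equal to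
the constant `M₀` (read from the chart at `γ 0`) both near `0` and near `1`. Proof verbatim from
`exists_loopFrame` (walk `exists_walkInv_one`; the intrinsic orientation character is constant
along `[0, 1]`, `posChar_iff_posChar`; closing path `exists_closingPath'`; one more
`walk_step`). [cite: HirschDT1976, Ch. 4 §4, Exercise 2 (p. 108)] -/
theorem exists_loopFrame' (hγ : ContMDiff 𝓘(ℝ, ℝ) 𝓘(ℝ, E) ∞ γ) (hper : ∀ t, γ (t + 1) = γ t)
    (hdim : Module.finrank ℝ E = Module.finrank ℝ F + 1)
    (hreg : ∀ t, chartVec E γ (γ t) t ≠ 0) (o : SmoothOrientation 𝓘(ℝ, E) X)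
    (R : E ≃L[ℝ] ℝ × F) {M₀ : F →L[ℝ] E} (hM₀ : IsFrame (chartVec E γ (γ 0) 0) M₀) :
    ∃ (Nf : ℝ → F →L[ℝ] E) (ε : ℝ), 0 < ε ∧ SmoothFrameOn γ Nf (Ioo (-ε) (1 + ε)) ∧
      (∀ t ∈ Icc (0 : ℝ) 1, FrameAt γ Nf t) ∧
      (∀ t ∈ Ioo (-ε) ε, Nf t = (τ (γ 0) (γ t) (γ t)).comp M₀) ∧
      (∀ t ∈ Ioo (1 - ε) (1 + ε), Nf t = (τ (γ 0) (γ t) (γ t)).comp M₀) := by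
  have hγc : Continuous γ := hγ.continuous
  set p₀ : X := γ 0 with hp₀
  obtain ⟨Nf, ε, p, M, hε, hsm, hval, h0, hfr⟩ :=
    exists_walkInv_one hγ hdim hreg (mem_chart_source E p₀) hM₀
  have hγ1 : γ 1 = p₀ := by rw [hp₀, ← hper 0, zero_add]
  -- room near `1` in the chart at `p₀`
  have h1p₀ : γ 1 ∈ (chartAt E p₀).source := by rw [hγ1]; exact mem_chart_source E p₀
  obtain ⟨η₁, hη₁, hη₁sub⟩ := exists_Ioo_subset_preimage_source (E := E) hγc h1p₀
  -- the velocity in the chart at `p₀`, and validity of `M₀` near `1`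
  set T : ℝ → E := chartVec E γ p₀ with hT
  have hT1 : T 1 = T 0 := by
    show chartVec E γ p₀ 1 = chartVec E γ p₀ 0
    rw [← chartVec_add_one hper p₀ 0, zero_add]
  have hTc : ContinuousOn T (γ ⁻¹' (chartAt E p₀).source) := continuousOn_chartVec hγ p₀
  have hTc1 : ContinuousAt T 1 :=
    hTc.continuousAt (((chartAt E p₀).open_source.preimage hγc).mem_nhds h1p₀)
  have hM₀' : ∀ᶠ t in 𝓝 1, IsFrame (T t) M₀ := by
    have hc : ContinuousAt (fun t => (T t, M₀)) 1 := hTc1.prodMk continuousAt_const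
    exact hc.preimage_mem_nhds (isOpen_setOf_isFrame.mem_nhds (by simpa [hT1] using hM₀))
  obtain ⟨η₂, hη₂, hη₂ball⟩ := Metric.eventually_nhds_iff_ball.1 hM₀'
  -- the parameter `b = 1 - η` where the closing starts
  set m : ℝ := min (min ε 1) (min η₁ η₂) with hm
  have hmpos : 0 < m := lt_min (lt_min hε one_pos) (lt_min hη₁ hη₂)
  have hmε : m ≤ ε := (min_le_left _ _).trans (min_le_left _ _)
  have hm1 : m ≤ 1 := (min_le_left _ _).trans (min_le_right _ _)
  have hmη₁ : m ≤ η₁ := (min_le_right _ _).trans (min_le_left _ _)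
  have hmη₂ : m ≤ η₂ := (min_le_right _ _).trans (min_le_right _ _)
  set η : ℝ := m / 2 with hη
  have hηpos : 0 < η := by positivity
  set b : ℝ := 1 - η with hb
  have hb0 : 0 ≤ b := by rw [hb, hη]; linarith
  have hb1 : b < 1 := by rw [hb]; linarith
  -- the walk data restricted to the frontier `b`
  have hbwin : ∀ t ∈ Ioo (b - η) (b + η), t ∈ Ioo (1 - ε) (1 + ε) := fun t ht =>
    ⟨by rw [hb, hη] at ht; linarith [ht.1], by rw [hb] at ht; linarith [ht.2]⟩
  have hfr_b : ∀ t ∈ Ioo (b - η) (b + η),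
      γ t ∈ (chartAt E p).source ∧ Nf t = (τ p (γ t) (γ t)).comp M := fun t ht => hfr t (hbwin t ht)
  have hsm_b : SmoothFrameOn γ Nf (Ioo (-η) (b + η)) :=
    hsm.mono (Ioo_subset_Ioo (by linarith) (by rw [hb]; linarith))
  have hval_b : ∀ t ∈ Icc 0 b, FrameAt γ Nf t := fun t ht => hval t ⟨ht.1, ht.2.trans hb1.le⟩
  have hIcc_src : ∀ t ∈ Icc b 1, γ t ∈ (chartAt E p₀).source := fun t ht =>
    hη₁sub ⟨by rw [hb, hη] at ht; linarith [ht.1], by linarith [ht.2]⟩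
  have hIcc_M₀ : ∀ t ∈ Icc b 1, IsFrame (T t) M₀ := fun t ht => hη₂ball t (by
    rw [Metric.mem_ball, Real.dist_eq, abs_lt]
    rw [hb, hη] at ht
    constructor <;> linarith [ht.1, ht.2])
  -- the germ at `b` and its validity
  have hbb : b ∈ Ioo (b - η) (b + η) := ⟨by linarith, by linarith⟩
  have hbsrc : γ b ∈ (chartAt E p₀).source := hIcc_src b ⟨le_rfl, hb1.le⟩
  set G : F →L[ℝ] E := (τ p p₀ (γ b)).comp M with hG_def
  have hG : IsFrame (T b) G :=
    isFrame_germ hγ (hfr_b b hbb).1 hbsrc (hfr_b b hbb).2 (hval b ⟨hb0, hb1.le⟩)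
  have hM₀b : IsFrame (T b) M₀ := hIcc_M₀ b ⟨le_rfl, hb1.le⟩
  -- the sign condition, from the orientation
  have hsign : 0 < frameDet R (T b) M₀ * frameDet R (T b) G := by
    -- the intrinsic characters at `0` and at `b` agree
    have hI := posChar_iff_posChar o (o p₀) R hγ isOpen_Ioo hsm (a := 0) (b := 1)
      (fun t ht => ⟨by linarith [ht.1], by linarith [ht.2]⟩) hval
      ⟨le_rfl, zero_le_one⟩ ⟨hb0, hb1.le⟩
    -- at `0`
    have hP0 : PosChar o (o p₀) R (γ 0) (chartVec E γ (γ 0) 0) (Nf 0) ↔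
        PosChar o (o p₀) R p₀ (T 0) M₀ := by
      rw [h0 0 ⟨by linarith, hε⟩, tangentCoordChange_self_eq (mem_extChartAt_source p₀),
        ContinuousLinearMap.id_comp]
    -- at `b`
    have hpiece : γ b ∈ connectedComponentIn (chartAt E p₀).source p₀ := by
      have h1 : γ '' Icc b 1 ⊆ connectedComponentIn (chartAt E p₀).source p₀ :=
        (isPreconnected_Icc.image γ hγc.continuousOn).subset_connectedComponentIn
          ⟨1, ⟨hb1.le, le_rfl⟩, hγ1⟩ (by rintro _ ⟨t, ht, rfl⟩; exact hIcc_src t ht)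
      exact h1 ⟨b, ⟨le_rfl, hb1.le⟩, rfl⟩
    have hNfb : Nf b = (τ p₀ (γ b) (γ b)).comp G := by
      rw [(hfr_b b hbb).2]
      exact rep_change (hfr_b b hbb).1 hbsrc M
    have hPb : PosChar o (o p₀) R (γ b) (chartVec E γ (γ b) b) (Nf b) ↔
        PosChar o (o p₀) R p₀ (T b) G := by
      have h := posChar_map_iff o (o p₀) R hpiece
        (mem_connectedComponentIn (mem_chart_source E (γ b))) hG
      rw [← chartVec_eq_tangentCoordChange hγ hbsrc (mem_chart_source E (γ b)), ← hNfb] at h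
      exact h
    have hA : 0 < frameDet R (T 0) M₀ ↔ 0 < frameDet R (T b) G := by
      have h := hP0.symm.trans (hI.trans hPb)
      unfold PosChar at h
      simpa only [eq_self_iff_true, iff_true] using h
    have h5 : 0 < frameDet R (T b) M₀ ↔ 0 < frameDet R (T 0) M₀ := by
      rw [← hT1]
      exact frameDet_pos_iff_of_isPreconnected R isPreconnected_Icc
        (hTc.mono fun t ht => hIcc_src t ht) continuousOn_const hIcc_M₀ ⟨le_rfl, hb1.le⟩
        ⟨hb1.le, le_rfl⟩
    have hne1 : frameDet R (T b) M₀ ≠ 0 := (isFrame_iff_frameDet_ne_zero R).1 hM₀b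
    have hne2 : frameDet R (T b) G ≠ 0 := (isFrame_iff_frameDet_ne_zero R).1 hG
    exact (mul_pos_iff_pos_iff_pos hne1 hne2).2 (h5.trans hA)
  -- the closing path and the last splice
  obtain ⟨π, hπ, hπ0, hπ1, hπv⟩ := exists_closingPath' R hM₀b hG hsign
  obtain ⟨Nf', ε', hε', hε'η, hsm', hval', -, h0', hfr'⟩ :=
    walk_step hγ hb0 hb1 hηpos hsm_b hval_b hfr_b hIcc_src hIcc_M₀ hπ hπ0 hπ1 fun s _ => hπv s
  refine ⟨Nf', ε', hε', hsm', hval', fun t ht => ?_, fun t ht => (hfr' t ht).2⟩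
  rw [h0' t ht]
  have : ε' ≤ ε := hε'η.trans (by rw [hη]; linarith)
  exact h0 t ⟨by linarith [ht.1], by linarith [ht.2]⟩

end LoopGeneral

end Literature.Topology.FourManifolds.CircleFraming

namespace Literature.Topology.FourManifolds

open CircleFraming

/-- Local notation: `𝔼 n` is the model Euclidean space `EuclideanSpace ℝ (Fin n)`. -/
local notation "𝔼 " n:arg => EuclideanSpace ℝ (Fin n)

/-- Local notation: `𝕊 n` is the unit sphere in `EuclideanSpace ℝ (Fin (n + 1))`. -/
local notation "𝕊 " n:arg => (Metric.sphere (0 : EuclideanSpace ℝ (Fin (n + 1))) 1)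

section Circle

/-- `circlePt 1 = ptA` (private copy, as in `NormalFramingOfCircle.lean`). [folklore] -/
private theorem circlePt_one_eq_ptA_aux' : circlePt 1 = ptA :=
  calc circlePt 1 = circlePt (0 + 1) := by norm_num
    _ = circlePt 0 := circlePt_add_one 0
    _ = ptA := rfl

end Circle

section DischargeGeneral

universe u

variable {m : ℕ} {X : Type u} [TopologicalSpace X] [ChartedSpace (𝔼 (m + 1)) X]
  [IsManifold (𝓡 (m + 1)) ∞ X]

/-- The velocity of the loop `t ↦ c (circlePt t)` of a smooth map `c : 𝕊¹ → X`, read in the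
chart at the current point, is the image of the velocity of `circlePt` under `dc` (any
dimension; as `chartVec_loop_eq`). [folklore] -/
theorem chartVec_loop_eq' {c : 𝕊 1 → X} (hc : ContMDiff (𝓡 1) (𝓡 (m + 1)) ∞ c) (t : ℝ) :
    chartVec (𝔼 (m + 1)) (fun t => c (circlePt t)) (c (circlePt t)) t =
      mfderiv (𝓡 1) (𝓡 (m + 1)) c (circlePt t) (mfderiv 𝓘(ℝ, ℝ) (𝓡 1) circlePt t (1 : ℝ)) := by
  set γ : ℝ → X := fun t => c (circlePt t) with hγ
  have hγs : ContMDiff 𝓘(ℝ, ℝ) (𝓡 (m + 1)) ∞ γ := hc.comp contMDiff_circlePt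
  -- the manifold derivative of `γ` through the chart at `γ t`
  have hD : HasDerivAt (extChartAt (𝓡 (m + 1)) (γ t) ∘ γ) (chartVec (𝔼 (m + 1)) γ (γ t) t) t :=
    hasDerivAt_extChartAt_comp hγs (mem_chart_source _ (γ t))
  have hM : HasMFDerivAt 𝓘(ℝ, ℝ) (𝓡 (m + 1)) γ t
      ((1 : ℝ →L[ℝ] ℝ).smulRight (chartVec (𝔼 (m + 1)) γ (γ t) t)) := by
    refine ⟨hγs.continuous.continuousAt, ?_⟩
    have h1 : writtenInExtChartAt 𝓘(ℝ, ℝ) (𝓡 (m + 1)) t γ = extChartAt (𝓡 (m + 1)) (γ t) ∘ γ := by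
      ext s
      simp only [writtenInExtChartAt, extChartAt_model_space_eq_id, PartialEquiv.refl_symm,
        PartialEquiv.refl_coe, comp_apply, id_eq]
    rw [h1, modelWithCornersSelf_coe, range_id, hasFDerivWithinAt_univ,
      extChartAt_model_space_eq_id, PartialEquiv.refl_coe, id_eq]
    exact hD.hasFDerivAt
  have hchain : mfderiv 𝓘(ℝ, ℝ) (𝓡 (m + 1)) γ t =
      (mfderiv (𝓡 1) (𝓡 (m + 1)) c (circlePt t)).comp (mfderiv 𝓘(ℝ, ℝ) (𝓡 1) circlePt t) := by
    rw [hγ]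
    exact mfderiv_comp t (hc.contMDiffAt.mdifferentiableAt (by simp))
      (contMDiff_circlePt.contMDiffAt.mdifferentiableAt (by simp))
  have hv : (mfderiv 𝓘(ℝ, ℝ) (𝓡 (m + 1)) γ t) (1 : ℝ) = chartVec (𝔼 (m + 1)) γ (γ t) t := by
    rw [hM.mfderiv]
    exact one_smul ℝ _
  rw [hchain] at hv
  exact hv.symm

/-- The loop of a smooth immersion of the circle has nonvanishing chart velocities (any
dimension; as `chartVec_loop_ne_zero`, with the embedding hypothesis weakened to injectivity of
the differential). [folklore] -/
theorem chartVec_loop_ne_zero' {c : 𝕊 1 → X} (hc : ContMDiff (𝓡 1) (𝓡 (m + 1)) ∞ c)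
    (himm : ∀ u, Injective (mfderiv (𝓡 1) (𝓡 (m + 1)) c u)) (t : ℝ) :
    chartVec (𝔼 (m + 1)) (fun t => c (circlePt t)) (c (circlePt t)) t ≠ 0 := by
  rw [chartVec_loop_eq' hc t]
  have h1 := mfderiv_circlePt_injective t
  have h2 : Injective (mfderiv (𝓡 1) (𝓡 (m + 1)) c (circlePt t)) := himm _
  intro h0
  have h3 : mfderiv 𝓘(ℝ, ℝ) (𝓡 1) circlePt t (1 : ℝ) = 0 := h2 (h0.trans (map_zero _).symm)
  have h4 : (1 : ℝ) = 0 := h1 (h3.trans (map_zero _).symm)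
  exact one_ne_zero h4

/-- **Normal framings of immersed circles in oriented manifolds (any dimension).** A smooth
immersion `c : 𝕊¹ → X` of the circle into a `C^∞` manifold charted on `ℝᵐ⁺¹` carrying a smooth
orientation has a normal framing: a family `N u : ℝᵐ →L ℝᵐ⁺¹ = T_{c u} X`, smooth along `c`,
with `(dc_u) ⊕ N u` bijective. Proof verbatim from `exists_normalFraming_of_isOrientable_holds`
(the 4-dimensional case): parametrise the circle by `t ↦ c (circlePt t)`, a smooth `1`-periodic
loop with nonvanishing chart velocities; walk a frame of the velocity along `[0, 1]` and close it
up using the orientation (`CircleFraming.exists_loopFrame'`, Hirsch's "an orientable bundle over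
the circle is trivial"); descend to `𝕊¹` through the angle functions `angA`, `angB`; finally
`range (dc_u)` is the line spanned by the velocity, so a frame of the velocity is exactly a
complement of `dc_u`. [cite: HirschDT1976, Ch. 4 §4, Exercise 2 (p. 108)] -/
theorem exists_normalFraming_of_smoothOrientation (o : SmoothOrientation (𝓡 (m + 1)) X)
    {c : 𝕊 1 → X} (hc : ContMDiff (𝓡 1) (𝓡 (m + 1)) ∞ c)
    (himm : ∀ u, Injective (mfderiv (𝓡 1) (𝓡 (m + 1)) c u)) :
    ∃ N : 𝕊 1 → (𝔼 m →L[ℝ] 𝔼 (m + 1)), IsSmoothAlong (𝓡 1) c N ∧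
      ∀ u : 𝕊 1, Bijective ((mfderiv (𝓡 1) (𝓡 (m + 1)) c u).coprod (N u)) := by
  set γ : ℝ → X := fun t => c (circlePt t) with hγdef
  have hγ : ContMDiff 𝓘(ℝ, ℝ) (𝓡 (m + 1)) ∞ γ := hc.comp contMDiff_circlePt
  have hγc : Continuous γ := hγ.continuous
  have hper : ∀ t, γ (t + 1) = γ t := fun t => by simp only [hγdef, circlePt_add_one]
  have hreg : ∀ t, chartVec (𝔼 (m + 1)) γ (γ t) t ≠ 0 := fun t => chartVec_loop_ne_zero' hc himm t
  have hdim : Module.finrank ℝ (𝔼 (m + 1)) = Module.finrank ℝ (𝔼 m) + 1 := by simp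
  obtain ⟨M₀, hM₀⟩ := exists_isFrame (F := 𝔼 m) hdim (hreg 0)
  have hR : Module.finrank ℝ (𝔼 (m + 1)) = Module.finrank ℝ (ℝ × 𝔼 m) := by
    simp [Module.finrank_prod, add_comm]
  let R : 𝔼 (m + 1) ≃L[ℝ] ℝ × 𝔼 m := ContinuousLinearEquiv.ofFinrankEq hR
  obtain ⟨Nf, ε, hε, hsm, hval, h0, h1⟩ := exists_loopFrame' hγ hper hdim hreg o R hM₀
  -- periodicity of the field near `0`
  have hNper : ∀ a ∈ Ioo (0 : ℝ) ε, Nf (a + 1) = Nf a := fun a ha => by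
    rw [h0 a ⟨by linarith [ha.1], ha.2⟩, h1 (a + 1) ⟨by linarith [ha.1], by linarith [ha.2]⟩, hper]
  refine ⟨fun u => Nf (angA u), fun p => ?_, fun u => ?_⟩
  · -- smoothness along `c`, read in the chart at `p`
    set G : ℝ → (𝔼 m →L[ℝ] 𝔼 (m + 1)) :=
      fun t => (tangentCoordChange (𝓡 (m + 1)) (γ t) p (γ t)).comp (Nf t) with hGdef
    have hO : IsOpen (Ioo (-ε) (1 + ε) ∩ γ ⁻¹' (chartAt (𝔼 (m + 1)) p).source) :=
      isOpen_Ioo.inter ((chartAt (𝔼 (m + 1)) p).open_source.preimage hγc)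
    have hG : ContDiffOn ℝ ∞ G (Ioo (-ε) (1 + ε) ∩ γ ⁻¹' (chartAt (𝔼 (m + 1)) p).source) := hsm p
    have hframeIn : ∀ u, frameIn c (fun u => Nf (angA u)) p u = G (angA u) := fun u => by
      have hcu : γ (angA u) = c u := by simp only [hγdef, circlePt_angA]
      simp only [frameIn, hGdef, hcu]
    intro u₀ hu₀
    suffices h : ContMDiffAt (𝓡 1) 𝓘(ℝ, 𝔼 m →L[ℝ] 𝔼 (m + 1)) ∞
        (frameIn c (fun u => Nf (angA u)) p) u₀ from h.contMDiffWithinAt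
    by_cases hA : u₀ = ptA
    · subst hA
      have hB : ContMDiffAt (𝓡 1) 𝓘(ℝ, ℝ) ∞ angB ptA := contMDiffAt_angB ptA_ne_ptB
      have hmem : (1 : ℝ) ∈ Ioo (-ε) (1 + ε) ∩ γ ⁻¹' (chartAt (𝔼 (m + 1)) p).source := by
        refine ⟨⟨by linarith, by linarith⟩, ?_⟩
        show γ 1 ∈ (chartAt (𝔼 (m + 1)) p).source
        have : γ 1 = c ptA := by simp only [hγdef, circlePt_one_eq_ptA_aux']
        rw [this]; exact hu₀
      have hG1 : ContDiffAt ℝ ∞ G (angB ptA) := by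
        rw [angB_ptA]; exact hG.contDiffAt (hO.mem_nhds hmem)
      refine (hG1.comp_contMDiffAt hB).congr_of_eventuallyEq ?_
      -- near `ptA` the readings through `angA` and `angB` agree
      have hev1 : ∀ᶠ u in 𝓝 ptA, angB u ∈ Ioo (1 - ε) (1 + ε) :=
        hB.continuousAt.preimage_mem_nhds
          (Ioo_mem_nhds (by rw [angB_ptA]; linarith) (by rw [angB_ptA]; linarith))
      have hev2 : ∀ᶠ u in 𝓝 ptA, u ≠ ptB := isOpen_ne.mem_nhds ptA_ne_ptB
      filter_upwards [hev1, hev2] with u hu1 hu2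
      rw [hframeIn u, comp_apply]
      by_cases huA : u = ptA
      · rw [huA, angA_ptA, angB_ptA]
      · rcases angB_eq_of_ne huA hu2 with ⟨-, hBeq⟩ | ⟨-, hBeq⟩
        · have ha : angA u ∈ Ioo (0 : ℝ) ε :=
            ⟨(angA_mem_Ioc u).1, by rw [hBeq] at hu1; linarith [hu1.2]⟩
          simp only [hGdef]
          rw [hBeq, hper, hNper _ ha]
        · rw [hBeq]
    · have hAsm : ContMDiffAt (𝓡 1) 𝓘(ℝ, ℝ) ∞ angA u₀ := contMDiffAt_angA hA
      have ht₀ : angA u₀ ∈ Ioo (0 : ℝ) 1 := angA_mem_Ioo hA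
      have hmem : angA u₀ ∈ Ioo (-ε) (1 + ε) ∩ γ ⁻¹' (chartAt (𝔼 (m + 1)) p).source := by
        refine ⟨⟨by linarith [ht₀.1], by linarith [ht₀.2]⟩, ?_⟩
        show γ (angA u₀) ∈ (chartAt (𝔼 (m + 1)) p).source
        have : γ (angA u₀) = c u₀ := by simp only [hγdef, circlePt_angA]
        rw [this]; exact hu₀
      have hG1 : ContDiffAt ℝ ∞ G (angA u₀) := hG.contDiffAt (hO.mem_nhds hmem)
      exact (hG1.comp_contMDiffAt hAsm).congr_of_eventuallyEq
        (Eventually.of_forall fun u => hframeIn u)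
  · -- frames: `range (dc_u)` is the line of the velocity
    set t : ℝ := angA u with ht
    have htI : t ∈ Ioc (0 : ℝ) 1 := angA_mem_Ioc u
    have hu : circlePt t = u := circlePt_angA u
    clear_value t
    subst hu
    show Bijective ((mfderiv (𝓡 1) (𝓡 (m + 1)) c (circlePt t)).coprod (Nf (angA (circlePt t))))
    rw [← ht]
    have hF : IsFrame (chartVec (𝔼 (m + 1)) γ (γ t) t) (Nf t) := hval t ⟨htI.1.le, htI.2⟩
    have hvel : chartVec (𝔼 (m + 1)) γ (γ t) t =
        mfderiv (𝓡 1) (𝓡 (m + 1)) c (circlePt t) (mfderiv 𝓘(ℝ, ℝ) (𝓡 1) circlePt t (1 : ℝ)) :=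
      chartVec_loop_eq' hc t
    rw [hvel] at hF
    have hne : mfderiv 𝓘(ℝ, ℝ) (𝓡 1) circlePt t (1 : ℝ) ≠ 0 := fun h0 => by
      have h10 : (1 : ℝ) = 0 := (mfderiv_circlePt_injective t) (h0.trans (map_zero _).symm)
      exact one_ne_zero h10
    have hV : Module.finrank ℝ (TangentSpace (𝓡 1) (circlePt t)) = 1 := by
      show Module.finrank ℝ (𝔼 1) = 1
      simp
    exact bijective_coprod_of_isFrame (E := 𝔼 (m + 1)) (F := 𝔼 m)
      (V := TangentSpace (𝓡 1) (circlePt t)) hV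
      (mfderiv (𝓡 1) (𝓡 (m + 1)) c (circlePt t)) hne hF

end DischargeGeneral

end Literature.Topology.FourManifolds

end
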